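import Literature.AlgebraicGeometry.Frobenioids.PadicFrobenioidBasePushIsoAbs
import Literature.AlgebraicGeometry.Frobenioids.PadicFrobenioidPairIsoExposed
import Literature.AlgebraicGeometry.Frobenioids.PadicFrobenioidPairIsoUnitsTransport
import Literature.AlgebraicGeometry.Frobenioids.PadicKummerIsoGInnerTwist
import Literature.AlgebraicGeometry.Frobenioids.PadicKummerThm24iFrobenioidRelOfEquivalence
import Literature.AlgebraicGeometry.Frobenioids.ModelFrobenioidPsiBEffective
import Literature.AlgebraicGeometry.Frobenioids.PadicKummerThm24iiGalois
import Literature.AlgebraicGeometry.Frobenioids.PadicKummerThm24iiOfEquivalenceAbs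
import Literature.AlgebraicGeometry.Frobenioids.PadicKummerThm24iiHOSquare
import Literature.AlgebraicGeometry.Frobenioids.PadicFrobenioidPsiBOfEquivalence
import Literature.AnabelianGeometry.AbsoluteAnabelian.AbsAnabUnitsTransportInnerTwist
import HarnessLib

/-!
# Frobenioids II, Theorem 2.4 (i)+(ii) for an equivalence `Ψ` of `p`-adic Frobenioids over the absolute bases `𝓑^temp(Πᵢ)⁰`,
# UNCONDITIONAL in the `μ_N`-square and in `Ψ_B` (T24ii-J2, piece P7 = P5b ∘ P5a ∘ P6)

Mochizuki, *The geometry of Frobenioids II*, Kyushu J. Math. **62** (2008) 401–460, §2, Theorem 2.4 pp. 19–21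
[cite: MochizukiFrdII2008, Thm 2.4 (ii) p.20]: "Assume that this isomorphism `G₁ ⥲ G₂` maps `H₁` onto `H₂`. Then: (i) … (ii) if the
`Φᵢ` are fieldwise saturated, then the isomorphism `F_N(A₁) ⥲ F_N(A₂)` of (i) is compatible with the natural isomorphisms
`F_N(Aᵢ) ⥲ ℤ/Nℤ`".

PROOF-ONLY knit (cell abc-iut, node FrdII:Thm2.4(ii), junction «T24ii-J2» piece P7; seat abc-iut-L1-d1 gen 7; the ASSEMBLY TEXT is
abc-iut-L1-t7 gen 8's `exists_thm24_ofEquivalenceAbs` (p473884, filed by adoption by abc-iut-E-t32) re-run VERBATIM with three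
changes): (1) the cofinal tower of open normal subgroups of `Π₁` is RE-BASED at `U_{A₁}` (`N 0 := U_{A₁}`, `N (k+1) := N₀ (m+k)`),
so that `A₁` IS the tower object `(Π₁/N_0, cls)` on the nose; (2) the component formula of the natural isomorphism
`εF : Ψ♭ ⋙ Base ⋙ incl ≅ Base ⋙ incl ⋙ φ_*` (abc-iut-L1-t7's `exists_basePushIso_relTop`) is KEPT, whence the base-point
compatibility `hpt` by `BaseGaloisSystem.pt_pushIso_hom_app_rQ`; (3) the `μ_N`-square hypothesis of clause (ii) is DISCHARGED by
abc-iut-L1-d1's `PadicKummer.Def22Context.hO_of_levelwise_basePush` (p473497), and the `Ψ_B`-binders `(Ψ_B, hΨB)` by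
abc-iut-L1-d3's `PadicFrd.Datum.exists_psiB_of_equivalence` (p471285, [FrdI] Thm. 3.4 (iii)/(iv) — no Cor. 4.11 hypothesis).
Result `exists_thm24_ofEquivalenceAbs_sq`: p473884's statement with the antecedent of its clause (ii) and the binders `Ψ_B`, `hΨB`
REMOVED — Theorem 2.4 (i) AND (ii) for ONE representative of `G₁ ⥲ G₂` over which `Ψ`'s `K̄₁^× ⥲ K̄₂^×` is THE [AbsAnab] units
transport, for every equivalence `Ψ` of `p`-adic Frobenioids over the genuine absolute bases, fieldwise saturated data, a
1-compatible base equivalence `(E, η)` ([FrdI] Thm. 3.4 (v)), `(N, Hᵢ)`-saturated objects with Galois bases, `μ_N(K̄ᵢ) ⊆ Lᵢ`, and the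
layers `Eᵢ` — the remaining printed hypothesis being exactly "this isomorphism maps `H₁` onto `H₂`" (`map_H`, inside the statement).
Theorems only; nothing here bears on [IUTchIII] Cor. 3.12; nothing asserts abc proved or refuted.
-/

noncomputable section

namespace Literature.AlgebraicGeometry.Frobenioids

namespace PadicKummer.Def22Context

open CategoryTheory CategoryTheory.Limits Opposite Topology Filter Field IntermediateField Kummer Function
open Literature.NumberTheory.GaloisRepresentations
open Literature.NumberTheory.GaloisRepresentations.LocalWeilDatum
open Literature.NumberTheory.GaloisRepresentations.DiscreteGaloisModule
open Literature.AnabelianGeometry.SemiGraphs QuasiTemperoid PadicFrd PadicFrd.Datum PadicFrd.Datum.GaloisChart PadicFrd.RelGal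
open Literature.AnabelianGeometry.AbsoluteAnabelian BaseGaloisSystem

variable {p₁ p₂ : ℕ} [Fact p₁.Prime] [Fact p₂.Prime]
  {P₁ : Type} [Group P₁] [TopologicalSpace P₁] [IsTopologicalGroup P₁] [SecondCountableTopology P₁] (hP₁ : IsTempered P₁)
  (hZ₁ : IsSlimGroup P₁) {φ₁ : P₁ →* GalFbar ℚ_[p₁]} {hφ₁ : IsOpenHom φ₁}
  {d₁ : PadicFrd.Datum (CosetCat P₁) p₁}
  (hd₁ : d₁.base = CosetCat.push φ₁ hφ₁.isOpenMap ⋙ CosetCat.toConnected (isTempered_galFbar ℚ_[p₁]) ⋙ galoisPadicFields p₁)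
  {P₂ : Type} [Group P₂] [TopologicalSpace P₂] [IsTopologicalGroup P₂] (hP₂ : IsTempered P₂) (hZ₂ : IsSlimGroup P₂)
  {φ₂ : P₂ →* GalFbar ℚ_[p₂]} {hφ₂ : IsOpenHom φ₂}
  {d₂ : PadicFrd.Datum (CosetCat P₂) p₂}
  (hd₂ : d₂.base = CosetCat.push φ₂ hφ₂.isOpenMap ⋙ CosetCat.toConnected (isTempered_galFbar ℚ_[p₂]) ⋙ galoisPadicFields p₂)
  (hfs₁ : d₁.IsFieldwiseSaturated) (hfs₂ : d₂.IsFieldwiseSaturated)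
  (Ψ : d₁.frobenioid ≌ d₂.frobenioid) (E : CosetCat P₁ ≌ CosetCat P₂)
  (η : Ψ.functor ⋙ ModelFrobenioid.baseFunctor d₂.Φ d₂.B d₂.divB ≅ ModelFrobenioid.baseFunctor d₁.Φ d₁.B d₁.divB ⋙ E.functor)
  {A₁ : d₁.frobenioid} (hA₁ : A₁.base.sg.toSubgroup.Normal) (hA₂ : (Ψ.functor.obj A₁).base.sg.toSubgroup.Normal)
  {H₁ : Subgroup (absoluteGaloisGroup (baseFld p₁ φ₁ hφ₁))} [H₁.Normal]
  {hH₁ : IsOpen (H₁ : Set (absoluteGaloisGroup (baseFld p₁ φ₁ hφ₁)))}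
  {H₂ : Subgroup (absoluteGaloisGroup (baseFld p₂ φ₂ hφ₂))} [H₂.Normal]
  {hH₂ : IsOpen (H₂ : Set (absoluteGaloisGroup (baseFld p₂ φ₂ hφ₂)))}
  (M : ℕ) [NeZero M]
  (hμ₁ : ∀ ζ : rootsOfUnity M (AlgebraicClosure (baseFld p₁ φ₁ hφ₁)),
    ((ζ : (AlgebraicClosure (baseFld p₁ φ₁ hφ₁))ˣ) : AlgebraicClosure (baseFld p₁ φ₁ hφ₁)) ∈
      objL φ₁ hφ₁ d₁.relTop (d₁.toRelTopFrob.obj A₁))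
  (hμ₂ : ∀ ζ : rootsOfUnity M (AlgebraicClosure (baseFld p₂ φ₂ hφ₂)),
    ((ζ : (AlgebraicClosure (baseFld p₂ φ₂ hφ₂))ˣ) : AlgebraicClosure (baseFld p₂ φ₂ hφ₂)) ∈
      objL φ₂ hφ₂ d₂.relTop (d₂.toRelTopFrob.obj (Ψ.functor.obj A₁)))
  (hc₁ : IsNHSaturated (contextOfObjectAbs φ₁ hφ₁ d₁ hd₁ A₁ hA₁ H₁ hH₁) M)
  (E₁ : Type) [Field E₁] [Algebra (baseFld p₁ φ₁ hφ₁) E₁] [FiniteDimensional (baseFld p₁ φ₁ hφ₁) E₁]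
  [Finite (MuCarrier E₁ M)] (hHE₁ : H₁ = galFixing (baseFld p₁ φ₁ hφ₁) (embField (baseFld p₁ φ₁ hφ₁) E₁))
  (E₂ : Type) [Field E₂] [Algebra (baseFld p₂ φ₂ hφ₂) E₂] [FiniteDimensional (baseFld p₂ φ₂ hφ₂) E₂]
  [Finite (MuCarrier E₂ M)] (hHE₂ : H₂ = galFixing (baseFld p₂ φ₂ hφ₂) (embField (baseFld p₂ φ₂ hφ₂) E₂))

include hP₁ hZ₁ hP₂ hZ₂ hfs₁ hfs₂ η in
/-- **[FrdII] Theorem 2.4 (i)+(ii) for an EQUIVALENCE `Ψ : C₁ ⥲ C₂` of `p`-adic Frobenioids over the absolute genuine bases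
`𝓑^temp(Πᵢ)⁰`, at `(N, Hᵢ)`-saturated objects `A₁`, `Ψ A₁` with Galois bases and `μ_N(K̄ᵢ) ⊆ Lᵢ` — ONE representative, (ii)
UNCONDITIONAL** (abc-iut-L1-t7's `exists_thm24_ofEquivalenceAbs` with the `μ_N`-square of clause (ii) and the `Ψ_B`-binders
discharged).  With the printed inputs BY NAME — a 1-compatible base equivalence `E`, `η` ([FrdI] Thm. 3.4 (v)), fieldwise
saturation, the layers `Eᵢ` (`Hᵢ = G_{Eᵢ}`) — there are `β : G_{K₁} ⥲ G_{K₂}` (a representative of the outer isomorphism lying under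
`Π₁ ⥲ Π₂`) and `ψ̄ : K̄₁^× ⥲ K̄₂^×`, `β`-equivariant, carrying `𝒪^×` onto `𝒪^×` and uniformisers to uniformisers, such that UNDER "this
isomorphism `G₁ ⥲ G₂` maps `H₁` onto `H₂`" (`map_H`, for `β`): the `Ψ`-induced isomorphism `e` of the Definition-2.2 contexts has
`e.isoG = β`, `e` on `Aut_C` IS `Ψ`, (i) `Thm24i` holds for `e`, and (ii) the invariants `invᵢ = inv_{Eᵢ} ∘ Θᵢ : F_N(Aᵢ) ⥲ ℤ/Nℤ`
pinned to the local-class-field-theory residue maps EXIST with `Thm24ii … (e.thm24Data N) inv₁ inv₂`.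
[cite: MochizukiFrdII2008, Thm 2.4 (ii) p.20] -/
theorem exists_thm24_ofEquivalenceAbs_sq (fs₁ fs₂ : Prop) :
    letI := PadicAlgCl.subfieldValuativeRel (baseFld p₁ φ₁ hφ₁)
    letI := PadicAlgCl.subfieldValuativeRel (baseFld p₂ φ₂ hφ₂)
    haveI := finiteDimensional_baseFld p₁ φ₁ hφ₁; haveI := finiteDimensional_baseFld p₂ φ₂ hφ₂
    haveI := PadicAlgCl.isNonarchimedeanLocalField_subfield (baseFld p₁ φ₁ hφ₁)
    haveI := PadicAlgCl.isNonarchimedeanLocalField_subfield (baseFld p₂ φ₂ hφ₂)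
    haveI := finiteDimensional_objL φ₁ hφ₁ d₁.relTop (d₁.toRelTopFrob.obj A₁)
    haveI := normal_objL φ₁ hφ₁ d₁.relTop (d₁.toRelTopFrob.obj A₁) hA₁
    haveI := finiteDimensional_objL φ₂ hφ₂ d₂.relTop (d₂.toRelTopFrob.obj (Ψ.functor.obj A₁))
    haveI := normal_objL φ₂ hφ₂ d₂.relTop (d₂.toRelTopFrob.obj (Ψ.functor.obj A₁)) hA₂
    haveI := locallyCompactSpace_H_contextOfObjectRel φ₁ hφ₁ d₁.relTop (d₁.relTop_base_eq φ₁ hφ₁ hd₁)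
      (d₁.toRelTopFrob.obj A₁) hA₁ H₁ hH₁
    haveI := locallyCompactSpace_H_contextOfObjectRel φ₂ hφ₂ d₂.relTop (d₂.relTop_base_eq φ₂ hφ₂ hd₂)
      (d₂.toRelTopFrob.obj (Ψ.functor.obj A₁)) hA₂ H₂ hH₂
    letI := (galoisChartRel φ₁ hφ₁ d₁.relTop (d₁.relTop_base_eq φ₁ hφ₁ hd₁) (d₁.toRelTopFrob.obj A₁) hA₁).galAction
    letI := (galoisChartRel φ₂ hφ₂ d₂.relTop (d₂.relTop_base_eq φ₂ hφ₂ hd₂)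
      (d₂.toRelTopFrob.obj (Ψ.functor.obj A₁)) hA₂).galAction
    letI := FiniteExtension.valuativeRel (baseFld p₁ φ₁ hφ₁) E₁
    letI := FiniteExtension.topologicalSpace (baseFld p₁ φ₁ hφ₁) E₁
    haveI := FiniteExtension.isNonarchimedeanLocalField (baseFld p₁ φ₁ hφ₁) E₁
    letI := FiniteExtension.valuativeRel (baseFld p₂ φ₂ hφ₂) E₂
    letI := FiniteExtension.topologicalSpace (baseFld p₂ φ₂ hφ₂) E₂
    haveI := FiniteExtension.isNonarchimedeanLocalField (baseFld p₂ φ₂ hφ₂) E₂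
    ∃ (β : absoluteGaloisGroup (baseFld p₁ φ₁ hφ₁) ≃ₜ* absoluteGaloisGroup (baseFld p₂ φ₂ hφ₂))
      (ψbar : (AlgebraicClosure (baseFld p₁ φ₁ hφ₁))ˣ ≃* (AlgebraicClosure (baseFld p₂ φ₂ hφ₂))ˣ),
      Prop121vii.IsAlphaEquivariant β ψbar ∧ Prop121vii.PreservesAbsUnits ψbar ∧ Prop121vii.PreservesUniformizers ψbar ∧
      ∀ map_H : H₁.map β.toMulEquiv.toMonoidHom = H₂,
        ∃ e : (contextOfObjectAbs φ₁ hφ₁ d₁ hd₁ A₁ hA₁ H₁ hH₁).Iso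
            (contextOfObjectAbs φ₂ hφ₂ d₂ hd₂ (Ψ.functor.obj A₁) hA₂ H₂ hH₂),
          -- `e.isoG` IS `β`, and `e` on `Aut_C` IS `Ψ`
          e.isoG = β ∧
          (∀ a : Aut (d₁.toRelTopFrob.obj A₁), (e.isoC a).hom = d₂.toRelTopFrob.map (Ψ.functor.map (d₁.ofRelTopFrob.map a.hom))) ∧
          -- Theorem 2.4 (i) for `e`
          (∀ (_ : fs₁ ↔ fs₂) (eFN₁ : FN (contextOfObjectAbs φ₁ hφ₁ d₁ hd₁ A₁ hA₁ H₁ hH₁) M ≃+ ZMod M),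
            Thm24i (contextOfObjectAbs φ₁ hφ₁ d₁ hd₁ A₁ hA₁ H₁ hH₁)
              (contextOfObjectAbs φ₂ hφ₂ d₂ hd₂ (Ψ.functor.obj A₁) hA₂ H₂ hH₂) M p₁ p₂ fs₁ fs₂ (e.thm24Data M)
              ((contextOfObjectAbs φ₁ hφ₁ d₁ hd₁ A₁ hA₁ H₁ hH₁).dualityIsoOfLocalDuality M eFN₁ hc₁
                (cupDualH_bijective_ofGalois_mlf p₁ (objL φ₁ hφ₁ d₁.relTop (d₁.toRelTopFrob.obj A₁)) H₁ hH₁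
                  (galoisChartRel φ₁ hφ₁ d₁.relTop (d₁.relTop_base_eq φ₁ hφ₁ hd₁) (d₁.toRelTopFrob.obj A₁) hA₁).res
                  (galoisChartRel φ₁ hφ₁ d₁.relTop (d₁.relTop_base_eq φ₁ hφ₁ hd₁) (d₁.toRelTopFrob.obj A₁) hA₁).res_smul
                  ((galoisChartRel φ₁ hφ₁ d₁.relTop (d₁.relTop_base_eq φ₁ hφ₁ hd₁) (d₁.toRelTopFrob.obj A₁)
                    hA₁).muModel M hμ₁)))
              ((contextOfObjectAbs φ₂ hφ₂ d₂ hd₂ (Ψ.functor.obj A₁) hA₂ H₂ hH₂).dualityIsoOfLocalDuality M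
                ((e.isoFN M).symm.trans eFN₁) ((e.isNHSaturated_iff M).mp hc₁)
                (cupDualH_bijective_ofGalois_mlf p₂ (objL φ₂ hφ₂ d₂.relTop (d₂.toRelTopFrob.obj (Ψ.functor.obj A₁))) H₂ hH₂
                  (galoisChartRel φ₂ hφ₂ d₂.relTop (d₂.relTop_base_eq φ₂ hφ₂ hd₂) (d₂.toRelTopFrob.obj (Ψ.functor.obj A₁))
                    hA₂).res
                  (galoisChartRel φ₂ hφ₂ d₂.relTop (d₂.relTop_base_eq φ₂ hφ₂ hd₂) (d₂.toRelTopFrob.obj (Ψ.functor.obj A₁))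
                    hA₂).res_smul
                  ((galoisChartRel φ₂ hφ₂ d₂.relTop (d₂.relTop_base_eq φ₂ hφ₂ hd₂)
                    (d₂.toRelTopFrob.obj (Ψ.functor.obj A₁)) hA₂).muModel M hμ₂)))) ∧
          -- Theorem 2.4 (ii) for `e`
          (∃ (invE₁ : galoisCohomology (mu E₁ M) 2 →+ ZMod M) (invE₂ : galoisCohomology (mu E₂ M) 2 →+ ZMod M)
              (inv₁ : FNInvariant (contextOfObjectAbs φ₁ hφ₁ d₁ hd₁ A₁ hA₁ H₁ hH₁) M)
              (inv₂ : FNInvariant (contextOfObjectAbs φ₂ hφ₂ d₂ hd₂ (Ψ.functor.obj A₁) hA₂ H₂ hH₂) M),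
              Prop121vii.IsInvariantMap E₁ M invE₁ ∧ Prop121vii.IsInvariantMap E₂ M invE₂ ∧
              (∀ x, inv₁.toAddEquiv x = invE₁ (fnLayerMap (objL φ₁ hφ₁ d₁.relTop (d₁.toRelTopFrob.obj A₁)) H₁ hH₁
                (galoisChartRel φ₁ hφ₁ d₁.relTop (d₁.relTop_base_eq φ₁ hφ₁ hd₁) (d₁.toRelTopFrob.obj A₁) hA₁).res
                (galoisChartRel φ₁ hφ₁ d₁.relTop (d₁.relTop_base_eq φ₁ hφ₁ hd₁) (d₁.toRelTopFrob.obj A₁) hA₁).res_smul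
                E₁ hHE₁ ((galoisChartRel φ₁ hφ₁ d₁.relTop (d₁.relTop_base_eq φ₁ hφ₁ hd₁) (d₁.toRelTopFrob.obj A₁)
                  hA₁).muModel M hμ₁) x)) ∧
              (∀ x, inv₂.toAddEquiv x = invE₂ (fnLayerMap (objL φ₂ hφ₂ d₂.relTop (d₂.toRelTopFrob.obj (Ψ.functor.obj A₁)))
                H₂ hH₂
                (galoisChartRel φ₂ hφ₂ d₂.relTop (d₂.relTop_base_eq φ₂ hφ₂ hd₂) (d₂.toRelTopFrob.obj (Ψ.functor.obj A₁))
                  hA₂).res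
                (galoisChartRel φ₂ hφ₂ d₂.relTop (d₂.relTop_base_eq φ₂ hφ₂ hd₂) (d₂.toRelTopFrob.obj (Ψ.functor.obj A₁))
                  hA₂).res_smul
                E₂ hHE₂ ((galoisChartRel φ₂ hφ₂ d₂.relTop (d₂.relTop_base_eq φ₂ hφ₂ hd₂)
                  (d₂.toRelTopFrob.obj (Ψ.functor.obj A₁)) hA₂).muModel M hμ₂) x)) ∧
              Thm24ii (contextOfObjectAbs φ₁ hφ₁ d₁ hd₁ A₁ hA₁ H₁ hH₁)
                (contextOfObjectAbs φ₂ hφ₂ d₂ hd₂ (Ψ.functor.obj A₁) hA₂ H₂ hH₂) M fs₁ fs₂ (e.thm24Data M) inv₁ inv₂) := by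
  letI := PadicAlgCl.subfieldValuativeRel (baseFld p₁ φ₁ hφ₁)
  letI := PadicAlgCl.subfieldValuativeRel (baseFld p₂ φ₂ hφ₂)
  haveI := finiteDimensional_baseFld p₁ φ₁ hφ₁; haveI := finiteDimensional_baseFld p₂ φ₂ hφ₂
  haveI := PadicAlgCl.isNonarchimedeanLocalField_subfield (baseFld p₁ φ₁ hφ₁)
  haveI := PadicAlgCl.isNonarchimedeanLocalField_subfield (baseFld p₂ φ₂ hφ₂)
  haveI : CharZero (baseFld p₁ φ₁ hφ₁) := charZero_of_injective_algebraMap (algebraMap ℚ_[p₁] (baseFld p₁ φ₁ hφ₁)).injective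
  haveI : CharZero (baseFld p₂ φ₂ hφ₂) := charZero_of_injective_algebraMap (algebraMap ℚ_[p₂] (baseFld p₂ φ₂ hφ₂)).injective
  haveI := finiteDimensional_objL φ₁ hφ₁ d₁.relTop (d₁.toRelTopFrob.obj A₁)
  haveI := normal_objL φ₁ hφ₁ d₁.relTop (d₁.toRelTopFrob.obj A₁) hA₁
  haveI := finiteDimensional_objL φ₂ hφ₂ d₂.relTop (d₂.toRelTopFrob.obj (Ψ.functor.obj A₁))
  haveI := normal_objL φ₂ hφ₂ d₂.relTop (d₂.toRelTopFrob.obj (Ψ.functor.obj A₁)) hA₂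
  -- the same two instances in the syntactic form `Ψ♭ A₁♭` (definitionally `(Ψ A₁)♭`) used by the Kummer-side lemmas
  haveI : FiniteDimensional (baseFld p₂ φ₂ hφ₂)
      (objL φ₂ hφ₂ d₂.relTop ((relTopEquivalence Ψ).functor.obj (d₁.toRelTopFrob.obj A₁))) :=
    finiteDimensional_objL φ₂ hφ₂ d₂.relTop _
  haveI : Normal (baseFld p₂ φ₂ hφ₂) (objL φ₂ hφ₂ d₂.relTop ((relTopEquivalence Ψ).functor.obj (d₁.toRelTopFrob.obj A₁))) :=
    normal_objL φ₂ hφ₂ d₂.relTop _ hA₂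
  haveI := locallyCompactSpace_H_contextOfObjectRel φ₁ hφ₁ d₁.relTop (d₁.relTop_base_eq φ₁ hφ₁ hd₁)
    (d₁.toRelTopFrob.obj A₁) hA₁ H₁ hH₁
  haveI := locallyCompactSpace_H_contextOfObjectRel φ₂ hφ₂ d₂.relTop (d₂.relTop_base_eq φ₂ hφ₂ hd₂)
    (d₂.toRelTopFrob.obj (Ψ.functor.obj A₁)) hA₂ H₂ hH₂
  letI := (galoisChartRel φ₁ hφ₁ d₁.relTop (d₁.relTop_base_eq φ₁ hφ₁ hd₁) (d₁.toRelTopFrob.obj A₁) hA₁).galAction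
  letI := (galoisChartRel φ₂ hφ₂ d₂.relTop (d₂.relTop_base_eq φ₂ hφ₂ hd₂)
    (d₂.toRelTopFrob.obj (Ψ.functor.obj A₁)) hA₂).galAction
  letI := (galoisChartRel φ₂ hφ₂ d₂.relTop (d₂.relTop_base_eq φ₂ hφ₂ hd₂)
    ((relTopEquivalence Ψ).functor.obj (d₁.toRelTopFrob.obj A₁)) hA₂).galAction
  haveI := hasColimitsOfShape_nat_commMonCat.{0}
  -- (`obtain`/`cases` is avoided below: with this goal it exhausts the elaborator; we peel existentials with `Exists.elim`)
  -- a cofinal tower of open normal subgroups of `Π₁`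
  -- the row-L02 slot `(Ψ_B, hΨB)` from `(E, η)` (abc-iut-L1-d3's P6, [FrdI] Thm. 3.4 (iii)/(iv))
  refine (PadicFrd.Datum.exists_psiB_of_equivalence hP₁ hZ₁ hP₂ hZ₂ Ψ E.functor η).elim fun ΨB hΨB => ?_
  refine (exists_antitone_cofinal_seq hP₁).elim fun N₀ hN₀ => ?_
  -- RE-BASE the tower at `U_{A₁}`: `N 0 := U_{A₁}`, `N (k+1) := N₀ (m+k)` with `N₀ m ⊆ U_{A₁}`, so that `A₁ = (Π₁/N_0, cls)`
  refine (hN₀.2 _ A₁.base.sg.mem_nhds_one).elim fun m hm => ?_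
  let N : ℕ → OpenNormalSubgroup P₁ := fun k =>
    @Nat.rec (fun _ => OpenNormalSubgroup P₁) { toOpenSubgroup := A₁.base.sg, isNormal' := hA₁ } (fun k _ => N₀ (m + k)) k
  have hN : Antitone N := by
    refine antitone_nat_of_succ_le fun k => ?_
    cases k with
    | zero => exact fun x hx => hm hx
    | succ k => exact hN₀.1 (Nat.le_succ (m + k))
  have hNb : ∀ U ∈ 𝓝 (1 : P₁), ∃ k, (N k : Set P₁) ⊆ U := fun U hU =>
    (hN₀.2 U hU).elim fun k hk => ⟨k + 1, fun x hx => hk (hN₀.1 (Nat.le_add_left k m) hx)⟩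
  -- abc-iut-w5-d229's witnesses, ONE run, straightening kept (piece P4)
  refine (exists_rep_basePt_seq φ₁ hφ₁ N).elim fun x₁ hx₁ => ?_
  refine (exists_pairIso_fbarUnits_straightened hP₁ hP₂ φ₁ hφ₁ φ₂ hφ₂ N hN d₁ d₂ hd₁ hd₂ hfs₁ hfs₂ E ΨB hNb x₁ hx₁).elim
    fun φ h => h.elim fun ψ h => h.elim fun N₂ h => h.elim fun hN₂ h => h.elim fun hN₂b h => h.elim fun _ h => h.elim
    fun ι h => h.elim fun ec h => h.elim fun x₂ h => h.elim fun hx₂ h => h.elim fun ι₁ h => h.elim fun ι₂ h => h.elim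
    fun ψbar h => ?_
  have hker := h.1; have hψ := h.2.1; have hstr := h.2.2.1; have hlw := h.2.2.2.2.1; have hleg₁ := h.2.2.2.2.2.1
  have hleg₂ := h.2.2.2.2.2.2.1; have hfac := h.2.2.2.2.2.2.2.1; have hσ := h.2.2.2.2.2.2.2.2.2
  -- `εF` at `θ := φ` (piece P3)
  refine (exists_basePushIso_relTop hP₁ hP₂ Ψ E η N hN hNb N₂ hN₂ hN₂b ι φ.toMulEquiv hstr).elim
    fun hφo h' => h'.elim fun hφrel h' => h'.elim fun εF hεF => ?_
  -- orientation (abc-iut-L1-d3's `hpos_of_equivalence`) and the [AbsAnab] chart pair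
  have hpos := fun (k : ℕ) (b : d₁.B.obj (op (cQ (N k)))) (c : d₁.Φ.obj (op (cQ (N k))))
    (hbc : Frobenioids.divB d₁.Φ d₁.B d₁.divB (op (cQ (N k))) b = Algebra.GrothendieckGroup.of c) =>
    PadicFrd.Datum.hpos_of_equivalence hP₁ hZ₁ hP₂ hZ₂ Ψ E.functor η ΨB hΨB (cQ (N k)) b c hbc
  have hint := norm_psibar_le_one_of_levelwise φ₁ hφ₁ φ₂ hφ₂ N hN d₁ d₂ hd₁ hd₂ hfs₁ E ΨB hNb hpos N₂ hN₂ ι ec x₁ x₂ ι₁ ι₂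
    ψbar hlw hleg₁ hleg₂ hfac
  refine (exists_absAnabChart_of_integral φ₁ hφ₁ φ₂ hφ₂ (valuation_le_one_iff_norm_le_one_subfield _)
    (valuation_le_one_iff_norm_le_one_subfield _) ψ ψbar hσ hint).elim fun α h'' => h''.elim fun ψn h'' => ?_
  have hα := h''.1; have hψn := h''.2.1; have heq := h''.2.2.1; have hu := h''.2.2.2.1; have hunif := h''.2.2.2.2
  -- the Kummer side AT `θ := φ`: "`Ψ` preserves `O^▷`" ([FrdI] Thm. 3.4 (iv), PROVED), `hkerθ`, the representative `β`
  have hO := PadicFrd.map_mem_endSubmonoid_iff hP₁ hZ₁ hP₂ hZ₂ (relTopEquivalence Ψ)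
  have hkerθ : ∀ x : P₁, φ₁ x = 1 ↔ φ₂ (φ.toMulEquiv.toMonoidHom x) = 1 := ker_iff_of_map_ker_eq φ₁ φ₂ φ.toMulEquiv hker
  let e₀ := baseIsoOfPush (relTopEquivalence Ψ).functor φ.toMulEquiv.toMonoidHom hφo εF (d₁.toRelTopFrob.obj A₁)
  let δ : absoluteGaloisGroup (baseFld p₂ φ₂ hφ₂) :=
    (galConjBase p₂ φ₂ hφ₂).symm (toIm φ₂ hφ₂ (baseRep (relTopEquivalence Ψ).functor φ.toMulEquiv.toMonoidHom hφo e₀))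
  let β := isoGOfTheta φ₁ hφ₁ φ₂ hφ₂ (relTopEquivalence Ψ).functor φ.toMulEquiv.toMonoidHom φ.continuous hφo φ.surjective
    hkerθ e₀
  have hψθ : ∀ g : P₁, (ψ ⟨φ₁ g, ⟨g, rfl⟩⟩ : GalFbar ℚ_[p₂]) = φ₂ (φ.toMulEquiv.toMonoidHom g) := hψ
  -- `isoG = Inn(δ⁻¹) ∘ α` (gen 7), so `δ⁻¹ • ψ̄♮` is THE units transport for `isoG`
  have hβψ : Prop121vii.IsAlphaEquivariant β (ψn.trans (MulDistribMulAction.toMulEquiv _ δ⁻¹)) :=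
    isAlphaEquivariant_isoGOfTheta_innerTwist φ₁ hφ₁ φ₂ hφ₂ _ _ φ.continuous hφo φ.surjective hkerθ e₀ ψ hψθ α hα heq
  have hβu : Prop121vii.PreservesAbsUnits (ψn.trans (MulDistribMulAction.toMulEquiv _ δ⁻¹)) := hu.innerTwist _
  have hβunif : Prop121vii.PreservesUniformizers (ψn.trans (MulDistribMulAction.toMulEquiv _ δ⁻¹)) := hunif.innerTwist _
  refine ⟨β, ψn.trans (MulDistribMulAction.toMulEquiv _ δ⁻¹), hβψ, hβu, hβunif, fun map_H => ?_⟩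
  -- THE `Ψ`-induced context isomorphism at `θ := φ` (gen 6's `isoOfFunctorRelBasePush`)
  let e := isoOfFunctorRelBasePush (d₁.relTop_base_eq φ₁ hφ₁ hd₁) (d₂.relTop_base_eq φ₂ hφ₂ hd₂) (relTopEquivalence Ψ).functor
    (A₁ := d₁.toRelTopFrob.obj A₁) hA₁ hA₂ (hO _) φ.toMulEquiv.toMonoidHom φ.continuous hφo φ.surjective hkerθ εF
    (hH₁ := hH₁) (hH₂ := hH₂) map_H
  have heG : e.isoG = β := rfl
  refine ⟨e, heG, fun a => rfl, fun hfs eFN₁ => ?_, ?_⟩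
  · -- Theorem 2.4 (i) for `e` (gen 6)
    exact thm24i_ofFunctorRel_ofBasePush (d₁.relTop_base_eq φ₁ hφ₁ hd₁) (d₂.relTop_base_eq φ₂ hφ₂ hd₂)
      (relTopEquivalence Ψ).functor (A₁ := d₁.toRelTopFrob.obj A₁) hA₁ hA₂ (hO _) φ.toMulEquiv.toMonoidHom φ.continuous
      hφo φ.surjective hkerθ εF map_H M hμ₁ hμ₂ fs₁ fs₂ hfs eFN₁ hc₁
  · -- Theorem 2.4 (ii) for `e` (abc-iut-w5-d201 / L2-t12's closer); the `μ_N`-square is abc-iut-L1-d1's P5a at the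
    -- tower object `(Π₁/N_0, cls) = A₁`, its base-point compatibility `hpt` read off the component formula of `εF`
    have h1 : εF.inv.app (d₁.toRelTopFrob.obj A₁) ≫ η.hom.app A₁ =
        (pushIso hP₁ ⊤ hP₂ ⊤ (CosetCat.relTopEquiv.symm.trans (E.trans CosetCat.relTopEquiv)) N hN (fun _ => le_top) hNb
          N₂ hN₂ (fun _ => le_top) hN₂b (Functor.isoWhiskerRight ι CosetCat.toRelTop.op) φ.toMulEquiv hφrel hφo).hom.app
          (d₁.toRelTopFrob.obj A₁).base := by
      rw [← cancel_epi (εF.hom.app (d₁.toRelTopFrob.obj A₁)), Iso.hom_inv_id_app_assoc, hεF]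
      erw [Category.assoc, Iso.inv_hom_id_app, Category.comp_id]
      try rfl
    have hpt : CosetCat.pt (εF.inv.app (d₁.toRelTopFrob.obj A₁) ≫ η.hom.app A₁) = CosetCat.pt (ι.hom.app 0).unop := by
      rw [h1]
      exact pt_pushIso_hom_app_rQ hP₁ ⊤ hP₂ ⊤ (CosetCat.relTopEquiv.symm.trans (E.trans CosetCat.relTopEquiv)) N hN
        (fun _ => le_top) hNb N₂ hN₂ (fun _ => le_top) hN₂b (Functor.isoWhiskerRight ι CosetCat.toRelTop.op) φ.toMulEquiv
        hφrel hφo 0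
    have hsq := hO_of_levelwise_basePush φ₁ hφ₁ φ₂ hφ₂ hd₁ hd₂ Ψ E.functor η ΨB hΨB N hN N₂ hN₂ 0 ι ec x₁ hx₁ x₂ hx₂ ι₁ ι₂
      ψbar hlw hleg₁ hleg₂ hfac ψn hψn A₁.cls hA₁ hA₂ (hO _) φ.toMulEquiv.toMonoidHom φ.continuous hφo φ.surjective hkerθ M
      hμ₁ hμ₂ εF (hH₁ := hH₁) (hH₂ := hH₂) map_H hpt
    have hc₂ : IsNHSaturated (contextOfObjectAbs φ₂ hφ₂ d₂ hd₂ (Ψ.functor.obj A₁) hA₂ H₂ hH₂) M :=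
      (e.isNHSaturated_iff M).mp hc₁
    exact Def22Context.Iso.exists_thm24ii_ofGalois e M
      ((galoisChartRel φ₁ hφ₁ d₁.relTop (d₁.relTop_base_eq φ₁ hφ₁ hd₁) (d₁.toRelTopFrob.obj A₁) hA₁).muModel M hμ₁)
      ((galoisChartRel φ₂ hφ₂ d₂.relTop (d₂.relTop_base_eq φ₂ hφ₂ hd₂) (d₂.toRelTopFrob.obj (Ψ.functor.obj A₁))
        hA₂).muModel M hμ₂)
      E₁ hHE₁ E₂ hHE₂ hc₁ hc₂ _ hβψ hβu hβunif hsq fs₁ fs₂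

end PadicKummer.Def22Context

end Literature.AlgebraicGeometry.Frobenioids

end
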